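import Summits.HodgeConjecture.HodgeConjecture.Theorems.R90S6OrbitNcardMulEquiv
import HarnessLib

/-!
# R90 · S6 «Ch. 14.1–14.5 stable trace formula» — WAVE 7 card W7-a.3: an automorphism respecting the `K`-law fixes
# every `K`-double coset once the index separates double cosets (`Theorems/R90S6MulEquivFixesDoubleCosets.lean`)

Cell `hodgecm-mathlib`, crux H413 (`stmt-HodgeConjecture-24833`), route of record `HCCMUnconditional`; programme R90-TF,
section S6 (base `R90-C14`), seat R90-C14-p06 (g0); S6 WAVE 7 (R90-C14-plan (g2), R90 bus 2026-09-04T23:08:14Z ∕ 23:10:40Z ∕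
23:14:13Z), card W7-a.3 of the typist's sheet `R90/R90-C14-typ1/g2/S6_wave7_targets.v1.712f4079a2a1dc1c.lean` :93–:96
(signature token-identical; namespace segment `.Wave7` dropped, as for W3∕W6).  Helper lane
`--supports stmt-HodgeConjecture-24833 --as helper`; THEOREMS ONLY (no definition, no instance, no notation, no named fact,
no `sorry`); imports = ★ `Theorems/R90S6OrbitNcardMulEquiv` (W7-a.2) + HarnessLib (no Lines import).

CONTENT (pure group theory).  If the index `g ↦ #(KgK ∕ K) = (K · gK).ncard` SEPARATES the `K`-double cosets of `G` (hypothesis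
`hsep`; load-bearing — it fails, correctly, for `K = ⊥ < G`; paid on path for the hyperspecial pairs `(U(J₀,N)(L_w), K₀)` by the
next wave W7-e), then every automorphism `θ` of `G` with the `K`-law `θ g ∈ K ↔ g ∈ K` satisfies `θ(g)K ∈ K · gK`, i.e.
`K θ(g) K = K g K`, for all `g`: by W7-a.2 (endo form `G' = G`, `K' = K`) the indices of `θ(g)` and `g` agree, and `hsep`
concludes.  ONE TERM.  Third of the four «eG-independence» lemmas (W7-a.1…a.4).

* **`mk_mulEquiv_mem_orbit_of_ncard_separates`** — W7-a.3.

HONEST LABEL: a helper theorem, count-neutral until the E1.3.9 assembly consumes W7-a.4; HC_CM is proved only modulo the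
7 printed citations (2 remaining named inputs: hLiu418 = stmt-HodgeConjecture-24832, h413 = stmt-HodgeConjecture-24833)
until rung 0 closes; REL ≠ ★ ≠ BUILT.

## References
* [ShimuraIATAF1971] G. Shimura, *Introduction to the arithmetic theory of automorphic functions* (1971), §3.1.
* [CartierCorvallis1979] P. Cartier, *Representations of 𝔭-adic groups: a survey*, PSPM 33.1 (1979), §I.3–I.4, §IV.1.
-/

set_option autoImplicit false
-- the mandated namespace repeats the single-problem summit's segment (`HodgeConjecture.HodgeConjecture`)
set_option linter.dupNamespace false

noncomputable section

open MulAction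
open Literature.NumberTheory.Automorphic

namespace Summit.HodgeConjecture.HodgeConjecture.R90.S6

/-- **W7-a.3** `mk_mulEquiv_mem_orbit_of_ncard_separates`: if the index `g ↦ #(KgK ∕ K)` SEPARATES the `K`-double cosets of `G`
(`hsep`) then every automorphism `θ` of `G` with `θ g ∈ K ↔ g ∈ K` satisfies `θ(g)K ∈ K · gK`, i.e. `K θ(g) K = K g K`, for all
`g` (W7-a.2 at `G' = G`, `K' = K`, then `hsep`). [folklore] -/
theorem mk_mulEquiv_mem_orbit_of_ncard_separates {G : Type*} [Group G] (K : Subgroup G) (θ : G ≃* G) (hθ : ∀ g, θ g ∈ K ↔ g ∈ K)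
    (hsep : ∀ g g' : G, (orbit K (g : G ⧸ K)).ncard = (orbit K (g' : G ⧸ K)).ncard → (g' : G ⧸ K) ∈ orbit K (g : G ⧸ K)) (g : G) :
    ((θ g : G) : G ⧸ K) ∈ orbit K (g : G ⧸ K) :=
  hsep g (θ g) (ncard_orbit_mk_mulEquiv_eq K K θ hθ g).symm

end Summit.HodgeConjecture.HodgeConjecture.R90.S6

end
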